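import Summits.CriticalPhenomena.PercolationContinuityZ3.Theorems.FK.PressureZeroTemperature
import Summits.CriticalPhenomena.PercolationContinuityZ3.Theorems.FK.PressureJointConvexity
import Summits.CriticalPhenomena.PercolationContinuityZ3.Theorems.FK.PressureBetaDerivativeField
import HarnessLib

/-!
# THE ENTROPY DENSITY OF THE ISING MODEL `s(β,h) = ψ(β,h) − β ∂ψ/∂β(β,h)`: `0 ≤ s ≤ log 2`, `s` IS NONINCREASING IN `β`,
# `s → log 2` AS `β → 0` AND `s → 0` AS `β → ∞` (THE THIRD LAW); finite volume: `0 ≤ S_Λ = log Z_Λ + β⟨H_Λ⟩ ≤ |Λ| log 2`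
# (Friedli–Velenik 2017, §3.2.1, Exercise 3.3, Thm. 3.6; Ruelle 1969, §2.6; Simon 1993, §II.3, §II.6)

Claimed R42 (8)(c) in the cell INBOX at 2026-08-29T04:00:50Z by fkp-10a gen 358 (NEW CLAIM #1 of the gen), addressed to coordinator fk-4 (next seated gen; gen 288 closed l.8706, (ι) in force); lineage row FO-10a-g358 (self-suggested), package g358-surface, label PS-E.
Helper file of the `fk-continuity` build cell (bschramm lane; `--supports stmt-CriticalPhenomena-4575`); builds on
p205010 (kernel theorem, internal audit signed; external expert review pending). No definitions, no named facts, no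
sorries; standard axioms. UNCONDITIONAL (nearest-neighbour Ising model on `ℤ^d`; finite-volume part on any locally
finite graph with any boundary condition).

No `entropy` is DEFINED (0 definitions): the statements are about `ψ(β,h) − β E^±(β,h)` with
`E⁺ = Σᵢ ⟨σ_0σ_{eᵢ}⟩⁺_{β,h} + h⟨σ_0⟩⁺_{β,h} = ∂⁺ψ/∂β` and `E^∅ = Σᵢ ⟨σ_0σ_{eᵢ}⟩^∅_{β,h} + h⟨σ_0⟩^∅_{β,h} = ∂⁻ψ/∂β` (`h ≥ 0`,
tree `hasDerivWithinAt_pressure_beta_Ici/Iic_field`); off `{h = 0, β > β_c}` both are `s = ψ − β ∂ψ/∂β`.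

Finite volume (any graph, volume, b.c., real `β`, `h`) — the Gibbs entropy `S_Λ = −Σ_τ p_τ log p_τ = log Z_Λ + β⟨H_Λ⟩_Λ`:
* `log_isingPartitionFunction_add_mul_isingExpect_nonneg` — `0 ≤ log Z^{bc}_{Λ;β,h} + β ⟨H^{bc}_{Λ;h}⟩^{bc}_{Λ;β,h}`;
* `log_isingPartitionFunction_add_mul_isingExpect_le` — `log Z + β⟨H⟩ ≤ |Λ| log 2` (the two-parameter Gibbs–Bogoliubov
  chord of `PressureJointConvexity` towards `β = 0`); `card_mul_log_two_le_log_isingPartitionFunction_free` —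
  `|Λ| log 2 ≤ log Z^∅_{Λ;β,h}` hence `log 2 ≤ ψ(β,h)` (`log_two_le_pressure`).
Infinite volume (`β ≥ 0`, `h ≥ 0`; by `ψ(β,−h) = ψ(β,h)` nothing is lost):
* **`pressure_sub_mul_plusEnergy_nonneg`** / `_freeEnergy_nonneg` — `0 ≤ ψ(β,h) − β E^±(β,h)` (`ψ ≥ β(d + h)`,
  `E^± ≤ d + h`); **`pressure_sub_mul_plusEnergy_le_log_two`** / `_freeEnergy_le_log_two` — `ψ − βE^± ≤ log 2`
  (convexity: `ψ(0,h) ≥ ψ(β,h) − β ∂^±ψ/∂β(β,h)`);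
* **`antitoneOn_pressure_sub_mul_plusEnergy`** — `β ↦ ψ(β,h) − βE⁺(β,h)` is nonincreasing on `[0,∞)` (convexity + GKS
  monotonicity of `E⁺`): the entropy decreases with inverse temperature;
* **`tendsto_pressure_sub_mul_plusEnergy_nhdsGE_zero`** — `ψ − βE⁺ → log 2` as `β → 0⁺` (infinite temperature);
* `mul_sub_plusEnergy_le` — `β((d + h) − E⁺) ≤ 2(ψ(β/2,h) − (β/2)(d + h))`; **`tendsto_plusEnergy_atTop`** — `E^± → d + h`;
* **THE THIRD LAW `tendsto_pressure_sub_mul_plusEnergy_atTop`** / `_freeEnergy_atTop` — `ψ(β,h) − βE^±(β,h) → 0` as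
  `β → ∞`, every `h ≥ 0` (`d ≥ 1`): no residual entropy (the `h = 0` case rests on `PressureZeroTemperature`);
* `pressure_sub_mul_deriv_mem_Icc` / `tendsto_pressure_sub_mul_deriv_atTop_of_pos_field` — the same with `deriv ψ(·,h)`, `h > 0`.

## References

* S. Friedli, Y. Velenik, *Statistical Mechanics of Lattice Systems*, CUP (2017), §3.2.1, Ex. 3.3, Thm. 3.6, §3.7. [FriedliVelenik2017]
* D. Ruelle, *Statistical Mechanics: Rigorous Results*, Benjamin (1969), §2.6 (pressure, energy, entropy). [Ruelle1969]
* B. Simon, *The Statistical Mechanics of Lattice Gases* I, Princeton (1993), §II.3, §II.6. [Simon1993]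
-/

noncomputable section

namespace Summit.CriticalPhenomena.PercolationContinuityZ3.Theorems.FK

namespace IsingPressure

open MeasureTheory Filter Topology Finset Set
open Literature.Probability.LatticeModels
open Summit.CriticalPhenomena.PercolationContinuityZ3.Theorems.FK.IsingEnergyDensity

variable {d : ℕ}

/-! ### Finite volume: `0 ≤ S_Λ ≤ |Λ| log 2` -/

section FiniteVolume

variable {V : Type*} (G : SimpleGraph V) [DecidableEq V] [G.LocallyFinite]

/-- **The finite-volume Gibbs entropy is nonnegative**: `0 ≤ log Z^{bc}_{Λ;β,h} + β⟨H^{bc}_{Λ;h}⟩^{bc}_{Λ;β,h}`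
(`= −Σ_τ p_τ log p_τ` with `p_τ = e^{−βH(τ)}/Z ≤ 1`). [cite: FriedliVelenik2017, §3.2.1 and Exercise 3.3; Ruelle1969, §2.6] -/
theorem log_isingPartitionFunction_add_mul_isingExpect_nonneg (Λ : Finset V) (β h : ℝ) (bc : BoundaryCondition V) :
    0 ≤ Real.log (isingPartitionFunction G Λ β h bc) +
      β * isingExpect G Λ β h bc (fun σ => isingHamiltonian G Λ h bc σ) := by
  have hZ := isingPartitionFunction_pos G Λ β h bc
  set p : (Λ → ℤˣ) → ℝ := fun τ => isingWeight G Λ β h bc τ / isingPartitionFunction G Λ β h bc with hp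
  have hp1 : ∑ τ, p τ = 1 := by
    rw [hp, ← Finset.sum_div, div_eq_one_iff_eq hZ.ne']; rfl
  have hple : ∀ τ, p τ ≤ 1 := fun τ => by
    rw [← hp1]
    exact single_le_sum (f := p) (fun τ' _ => (div_pos (isingWeight_pos G Λ β h bc τ') hZ).le) (mem_univ τ)
  have hppos : ∀ τ, 0 < p τ := fun τ => div_pos (isingWeight_pos G Λ β h bc τ) hZ
  -- `log Z + β H(τ) = - log p_τ`
  have hlogp : ∀ τ, Real.log (isingPartitionFunction G Λ β h bc) + β * isingHamiltonian G Λ h bc (glue Λ τ bc) =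
      -Real.log (p τ) := fun τ => by
    rw [hp, Real.log_div (isingWeight_pos G Λ β h bc τ).ne' hZ.ne', isingWeight, Real.log_exp]
    ring
  have hE : isingExpect G Λ β h bc (fun σ => isingHamiltonian G Λ h bc σ) =
      ∑ τ, p τ * isingHamiltonian G Λ h bc (glue Λ τ bc) := by
    rw [isingExpect, integral_isingMeasure G Λ β h bc (measurable_isingHamiltonian G Λ h bc), Finset.sum_div]
    exact sum_congr rfl fun τ _ => by rw [hp]; ring
  calc (0 : ℝ) ≤ ∑ τ, p τ * (-Real.log (p τ)) :=
        sum_nonneg fun τ _ => mul_nonneg (hppos τ).le (neg_nonneg.2 (Real.log_nonpos (hppos τ).le (hple τ)))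
    _ = ∑ τ, p τ * (Real.log (isingPartitionFunction G Λ β h bc) + β * isingHamiltonian G Λ h bc (glue Λ τ bc)) :=
        sum_congr rfl fun τ _ => by rw [hlogp]
    _ = Real.log (isingPartitionFunction G Λ β h bc) + β * isingExpect G Λ β h bc (fun σ => isingHamiltonian G Λ h bc σ) := by
        rw [hE, mul_sum]
        simp_rw [mul_add]
        rw [sum_add_distrib, ← sum_mul, hp1, one_mul]
        congr 1
        exact sum_congr rfl fun τ _ => by ring

/-- **The finite-volume Gibbs entropy is at most `|Λ| log 2`**: `log Z^{bc}_{Λ;β,h} + β⟨H⟩_{Λ;β,h} ≤ |Λ| log 2` (the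
Gibbs–Bogoliubov chord from `(β,h)` to `β = 0`, where `Z = 2^{|Λ|}`). [cite: FriedliVelenik2017, Exercise 3.2 and Thm. 3.6 (proof); Ruelle1969, §2.6] -/
theorem log_isingPartitionFunction_add_mul_isingExpect_le (Λ : Finset V) (β h : ℝ) (bc : BoundaryCondition V) :
    Real.log (isingPartitionFunction G Λ β h bc) + β * isingExpect G Λ β h bc (fun σ => isingHamiltonian G Λ h bc σ) ≤
      #Λ * Real.log 2 := by
  have h1 := isingExpect_sub_le_log_sub G Λ β h 0 h bc
  have hfun : (fun σ => β * isingHamiltonian G Λ h bc σ - 0 * isingHamiltonian G Λ h bc σ) =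
      fun σ => β * isingHamiltonian G Λ h bc σ := funext fun σ => by ring
  rw [hfun, isingExpect_const_mul' G Λ h bc β β (measurable_isingHamiltonian G Λ h bc),
    isingPartitionFunction_zero_beta, Real.log_pow] at h1
  linarith

/-- **`|Λ| log 2 ≤ log Z^∅_{Λ;β,h}`** (free boundary condition, all real `β`, `h`): the Gibbs–Bogoliubov chord from
`β = 0` (where every bond and spin has mean zero) to `(β,h)`. [cite: FriedliVelenik2017, Exercise 3.2 and Thm. 3.6 (proof)] -/
theorem card_mul_log_two_le_log_isingPartitionFunction_free (Λ : Finset V) (β h : ℝ) :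
    #Λ * Real.log 2 ≤ Real.log (isingPartitionFunction G Λ β h .free) := by
  have h1 := isingExpect_sub_le_log_sub G Λ 0 h β h .free
  have hfun : (fun σ => 0 * isingHamiltonian G Λ h .free σ - β * isingHamiltonian G Λ h .free σ) =
      fun σ => (-β) * isingHamiltonian G Λ h .free σ := funext fun σ => by ring
  rw [hfun, isingExpect_const_mul' G Λ h .free 0 (-β) (measurable_isingHamiltonian G Λ h .free),
    isingPartitionFunction_zero_beta, Real.log_pow] at h1
  -- `log Z(β,h) ≥ |Λ| log 2 − β⟨H⟩_{0,h}` and at `β = 0` the free measure is uniform: `⟨H⟩_{0,h} = 0`.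
  have hH0 : isingExpect G Λ 0 h .free (fun σ => isingHamiltonian G Λ h .free σ) = 0 := by
    rw [isingExpect, integral_isingMeasure G Λ 0 h .free (measurable_isingHamiltonian G Λ h .free)]
    simp only [isingWeight, neg_zero, zero_mul, Real.exp_zero, one_mul]
    rw [div_eq_zero_iff]
    left
    -- `Σ_τ H(τ) = −Σ_τ Σ_e σ_e(τ) − h Σ_τ Σ_x σ_x(τ)`; the field part vanishes under the global flip `τ ↦ −τ`, the bond
    -- part edge by edge under the flip of one endpoint.
    classical
    unfold isingHamiltonian
    rw [interactionEdges_free]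
    -- field part: global flip
    have hfield : ∑ τ : Λ → ℤˣ, ∑ x ∈ Λ, spinAt x (glue Λ τ .free) = 0 := by
      have hinv : ∑ τ : Λ → ℤˣ, ∑ x ∈ Λ, spinAt x (glue Λ τ .free) =
          ∑ τ : Λ → ℤˣ, ∑ x ∈ Λ, spinAt x (glue Λ (-τ) .free) :=
        (Equiv.sum_comp (Equiv.neg (Λ → ℤˣ)) (fun τ => ∑ x ∈ Λ, spinAt x (glue Λ τ .free))).symm
      have hneg : ∀ τ : Λ → ℤˣ, ∑ x ∈ Λ, spinAt x (glue Λ (-τ) .free) = -∑ x ∈ Λ, spinAt x (glue Λ τ .free) := by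
        intro τ
        rw [← sum_neg_distrib]
        refine sum_congr rfl fun x hx => ?_
        simp [spinAt, hx, Units.val_neg]
      simp_rw [hneg, sum_neg_distrib] at hinv
      linarith
    -- bond part: each bond `s(x,y)` with `x ≠ y`, `x ∈ Λ`: flip the spin at `x` only
    have hbond : ∑ τ : Λ → ℤˣ, ∑ e ∈ edgesIn G Λ, bondSpin (glue Λ τ .free) e = 0 := by
      rw [sum_comm]
      refine sum_eq_zero fun e he => ?_
      induction e using Sym2.ind with
      | _ x y =>
        have hx : x ∈ Λ := (mem_edgesIn_iff.1 he).2 x (Sym2.mem_mk_left x y)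
        have hy : y ∈ Λ := (mem_edgesIn_iff.1 he).2 y (Sym2.mem_mk_right x y)
        have hxy : x ≠ y := G.ne_of_adj (mem_edgesIn_iff.1 he).1
        -- the involution flipping the spin at `x`
        set F : (Λ → ℤˣ) → (Λ → ℤˣ) := fun τ => Function.update τ ⟨x, hx⟩ (-τ ⟨x, hx⟩) with hF
        have hFF : ∀ τ, F (F τ) = τ := fun τ => by
          funext z
          by_cases hz : z = ⟨x, hx⟩
          · subst hz; simp [hF]
          · simp [hF, hz]
        let eF : (Λ → ℤˣ) ≃ (Λ → ℤˣ) := ⟨F, F, hFF, hFF⟩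
        have hinv := (Equiv.sum_comp eF (fun τ => bondSpin (glue Λ τ .free) s(x, y))).symm
        have hneg : ∀ τ : Λ → ℤˣ, bondSpin (glue Λ (F τ) .free) s(x, y) = -bondSpin (glue Λ τ .free) s(x, y) := by
          intro τ
          have hyx : (⟨y, hy⟩ : Λ) ≠ ⟨x, hx⟩ := fun h' => hxy (Subtype.ext_iff.1 h').symm
          rw [bondSpin_glue_free_mk _ hx hy, bondSpin_glue_free_mk _ hx hy]
          simp [hF, hyx, Units.val_neg]
        change ∑ τ, bondSpin (glue Λ τ .free) s(x, y) = ∑ τ, bondSpin (glue Λ (eF τ) .free) s(x, y) at hinv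
        simp_rw [show ∀ τ, eF τ = F τ from fun _ => rfl, hneg, sum_neg_distrib] at hinv
        linarith
    have hsplit : ∀ τ : Λ → ℤˣ, (-(∑ e ∈ edgesIn G Λ, bondSpin (glue Λ τ .free) e) - h * ∑ x ∈ Λ, spinAt x (glue Λ τ .free))
        = (-1) * (∑ e ∈ edgesIn G Λ, bondSpin (glue Λ τ .free) e) + (-h) * ∑ x ∈ Λ, spinAt x (glue Λ τ .free) :=
      fun τ => by ring
    rw [sum_congr rfl fun τ _ => hsplit τ, sum_add_distrib, ← mul_sum, ← mul_sum, hbond, hfield]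
    ring
  rw [hH0, mul_zero] at h1
  linarith

end FiniteVolume

/-- **`log 2 ≤ ψ(β,h)` for all real `β`, `h`** (`Z^∅_Λ ≥ 2^{|Λ|}` by Jensen at infinite temperature).
[cite: FriedliVelenik2017, Exercise 3.2 and Thm. 3.6] -/
theorem log_two_le_pressure (β h : ℝ) : Real.log 2 ≤ pressure d β h := by
  have hlim : Tendsto (fun L : ℕ => pressureIn (zdGraph d) (box d L) β h .free) atTop (𝓝 (pressure d β h)) :=
    hasBoxLimit_pressureIn_holds (d := d) β h .free
  refine ge_of_tendsto' hlim fun L => ?_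
  have hpos : (0 : ℝ) < #(box d L) := by exact_mod_cast (box_nonempty d L).card_pos
  rw [pressureIn, le_div_iff₀ hpos, mul_comm]
  exact card_mul_log_two_le_log_isingPartitionFunction_free (zdGraph d) (box d L) β h

/-! ### Infinite volume: `0 ≤ ψ − β E^± ≤ log 2` -/

/-- **`0 ≤ ψ(β,h) − β E⁺(β,h)`** for `β, h ≥ 0` (`ψ ≥ β(d + h)` and `E⁺ ≤ d + h`): the entropy density is nonnegative.
[cite: Ruelle1969, §2.6; FriedliVelenik2017, Exercise 3.3] -/
theorem pressure_sub_mul_plusEnergy_nonneg {β h : ℝ} (hβ : 0 ≤ β) (hh : 0 ≤ h) :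
    0 ≤ pressure d β h - β * (∑ i, plusCorr d β h {0, Pi.single i 1} + h * plusCorr d β h {0}) := by
  have h1 := mul_add_abs_le_pressure (d := d) β h
  rw [abs_of_nonneg hh] at h1
  have h2 : ∑ i, plusCorr d β h {0, Pi.single i 1} + h * plusCorr d β h {0} ≤ d + h := by
    have hs : ∑ i, plusCorr d β h ({0, Pi.single i 1} : Finset (Site d)) ≤ ∑ _i : Fin d, (1 : ℝ) :=
      sum_le_sum fun i _ => plusCorr_le_one hβ hh _
    have hm : h * plusCorr d β h {0} ≤ h * 1 := mul_le_mul_of_nonneg_left (plusCorr_le_one hβ hh _) hh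
    simp only [sum_const, card_univ, Fintype.card_fin, nsmul_eq_mul, mul_one] at hs hm
    linarith
  nlinarith

/-- **`0 ≤ ψ(β,h) − β E^∅(β,h)`** for `β, h ≥ 0` (`E^∅ ≤ E⁺`). [cite: Ruelle1969, §2.6; FriedliVelenik2017, Exercise 3.3] -/
theorem pressure_sub_mul_freeEnergyDensity_nonneg {β h : ℝ} (hβ : 0 ≤ β) (hh : 0 ≤ h) :
    0 ≤ pressure d β h - β * (∑ i, freeCorr d β h {0, Pi.single i 1} + h * freeCorr d β h {0}) := by
  have h1 := pressure_sub_mul_plusEnergy_nonneg (d := d) hβ hh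
  have h2 := mul_le_mul_of_nonneg_left (freeEnergyField_le_plusEnergyField (d := d) hβ hh) hβ
  linarith

/-- **`ψ(β,h) − β E^∅(β,h) ≤ log 2`** for `β > 0`, `h ≥ 0` (convexity of `ψ(·,h)`: the chord from `0` to `β` has slope
`≤ ∂⁻ψ/∂β(β,h) = E^∅(β,h)`, and `ψ(0,h) = log 2`). [cite: Ruelle1969, §2.6; FriedliVelenik2017, Thm. 3.6 and Exercise 3.3] -/
theorem pressure_sub_mul_freeEnergyDensity_le_log_two {β h : ℝ} (hβ : 0 < β) (hh : 0 ≤ h) :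
    pressure d β h - β * (∑ i, freeCorr d β h {0, Pi.single i 1} + h * freeCorr d β h {0}) ≤ Real.log 2 := by
  have h1 := slope_pressure_beta_le_field (d := d) hβ.le hβ hh
  rw [slope_def_field, sub_zero, div_le_iff₀ hβ] at h1
  have h0 : pressure d 0 h = Real.log 2 := by
    have := tendsto_nhds_unique ((IsingEnergyDensity.continuous_pressure_beta (d := d) h).tendsto 0)
      (tendsto_pressure_nhds_zero_beta (d := d) h)
    exact this
  linarith [mul_comm β (∑ i, freeCorr d β h {0, Pi.single i 1} + h * freeCorr d β h {0})]

/-- **`ψ(β,h) − β E⁺(β,h) ≤ log 2`** for `β > 0`, `h ≥ 0` (`E^∅ ≤ E⁺`): the entropy density is at most `log 2`.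
[cite: Ruelle1969, §2.6; FriedliVelenik2017, Thm. 3.6 and Exercise 3.3] -/
theorem pressure_sub_mul_plusEnergy_le_log_two {β h : ℝ} (hβ : 0 < β) (hh : 0 ≤ h) :
    pressure d β h - β * (∑ i, plusCorr d β h {0, Pi.single i 1} + h * plusCorr d β h {0}) ≤ Real.log 2 := by
  have h1 := pressure_sub_mul_freeEnergyDensity_le_log_two (d := d) hβ hh
  have h2 := mul_le_mul_of_nonneg_left (freeEnergyField_le_plusEnergyField (d := d) hβ.le hh) hβ.le
  linarith

/-! ### Monotonicity in `β` and the infinite-temperature limit -/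

/-- **The entropy density is nonincreasing in `β`**: `β ↦ ψ(β,h) − β E⁺(β,h)` is antitone on `[0,∞)` (`h ≥ 0`):
for `β₁ < β₂`, `ψ(β₂) − ψ(β₁) ≤ (β₂ − β₁)E^∅(β₂) ≤ (β₂ − β₁)E⁺(β₂)` (convexity) and `E⁺(β₁) ≤ E⁺(β₂)` (GKS).
[cite: Ruelle1969, §2.6; FriedliVelenik2017, Thm. 3.6, Lemma 3.31] -/
theorem antitoneOn_pressure_sub_mul_plusEnergy {h : ℝ} (hh : 0 ≤ h) :
    AntitoneOn (fun β => pressure d β h - β * (∑ i, plusCorr d β h {0, Pi.single i 1} + h * plusCorr d β h {0}))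
      (Ici 0) := by
  intro β₁ hβ₁ β₂ hβ₂ hle
  rcases hle.eq_or_lt with rfl | hlt
  · exact le_rfl
  have h0 : 0 ≤ β₁ := hβ₁
  have hslope := (slope_pressure_beta_le_field (d := d) hβ₂ hlt hh).trans (freeEnergyField_le_plusEnergyField hβ₂ hh)
  rw [slope_def_field, div_le_iff₀ (sub_pos.2 hlt)] at hslope
  have hmono : ∑ i, plusCorr d β₁ h {0, Pi.single i 1} + h * plusCorr d β₁ h {0} ≤
      ∑ i, plusCorr d β₂ h {0, Pi.single i 1} + h * plusCorr d β₂ h {0} :=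
    add_le_add (sum_le_sum fun i _ => plusCorr_mono_params h0 hle hh le_rfl _)
      (mul_le_mul_of_nonneg_left (plusCorr_mono_params h0 hle hh le_rfl _) hh)
  dsimp only
  nlinarith [mul_le_mul_of_nonneg_left hmono h0,
    mul_comm (β₂ - β₁) (∑ i, plusCorr d β₂ h {0, Pi.single i 1} + h * plusCorr d β₂ h {0})]

/-- **Infinite temperature: `ψ(β,h) − β E⁺(β,h) → log 2` as `β → 0⁺`** (`h ≥ 0`; `E⁺` stays in `[0, d + h]` and
`ψ(β,h) → log 2`). [cite: FriedliVelenik2017, Thm. 3.6; Ruelle1969, §2.6] -/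
theorem tendsto_pressure_sub_mul_plusEnergy_nhdsGE_zero {h : ℝ} (hh : 0 ≤ h) :
    Tendsto (fun β => pressure d β h - β * (∑ i, plusCorr d β h {0, Pi.single i 1} + h * plusCorr d β h {0}))
      (𝓝[≥] 0) (𝓝 (Real.log 2)) := by
  have hψ : Tendsto (fun β => pressure d β h) (𝓝[≥] 0) (𝓝 (Real.log 2)) :=
    (tendsto_pressure_nhds_zero_beta (d := d) h).mono_left nhdsWithin_le_nhds
  -- `β E⁺(β,h) → 0`: `|β E⁺| ≤ β (d + h)`
  have hprod : Tendsto (fun β => β * (∑ i, plusCorr d β h {0, Pi.single i 1} + h * plusCorr d β h {0}))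
      (𝓝[≥] 0) (𝓝 0) := by
    have hb : Tendsto (fun β : ℝ => β * (d + h)) (𝓝[≥] 0) (𝓝 (0 * (d + h))) :=
      (tendsto_id.mono_left nhdsWithin_le_nhds).mul_const _
    rw [zero_mul] at hb
    refine squeeze_zero' ?_ ?_ hb
    · filter_upwards [self_mem_nhdsWithin] with β hβ
      exact mul_nonneg hβ (add_nonneg (sum_nonneg fun i _ => plusCorr_nonneg hβ hh _)
        (mul_nonneg hh (plusCorr_nonneg hβ hh _)))
    · filter_upwards [self_mem_nhdsWithin] with β hβ
      refine mul_le_mul_of_nonneg_left ?_ hβ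
      have hs : ∑ i, plusCorr d β h ({0, Pi.single i 1} : Finset (Site d)) ≤ ∑ _i : Fin d, (1 : ℝ) :=
        sum_le_sum fun i _ => plusCorr_le_one hβ hh _
      have hm : h * plusCorr d β h {0} ≤ h * 1 := mul_le_mul_of_nonneg_left (plusCorr_le_one hβ hh _) hh
      simp only [sum_const, card_univ, Fintype.card_fin, nsmul_eq_mul, mul_one] at hs hm
      linarith
  have := hψ.sub hprod
  rwa [sub_zero] at this

/-! ### Zero temperature: `E^± → d + h` and the third law `ψ − βE^± → 0` -/

/-- **`β ((d + h) − E^∅(β,h)) ≤ 2 (ψ(β/2,h) − (β/2)(d + h))`** for `β > 0`, `h ≥ 0` (convexity: `E^∅(β,h) ≥` the chord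
slope from `β/2` to `β`, and `ψ(β,h) ≥ β(d + h)`). [cite: Ruelle1969, §2.6; FriedliVelenik2017, Thm. 3.6 and Exercise 3.3] -/
theorem mul_sub_freeEnergyDensity_le {β h : ℝ} (hβ : 0 < β) (hh : 0 ≤ h) :
    β * ((d + h) - (∑ i, freeCorr d β h {0, Pi.single i 1} + h * freeCorr d β h {0})) ≤
      2 * (pressure d (β / 2) h - β / 2 * (d + h)) := by
  have hslope := slope_pressure_beta_le_field (d := d) hβ.le (show β / 2 < β by linarith) hh
  rw [slope_def_field, div_le_iff₀ (by linarith : 0 < β - β / 2)] at hslope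
  have hlo := mul_add_abs_le_pressure (d := d) β h
  rw [abs_of_nonneg hh] at hlo
  nlinarith [mul_comm (β - β / 2) (∑ i, freeCorr d β h {0, Pi.single i 1} + h * freeCorr d β h {0})]

/-- **`β ((d + h) − E⁺(β,h)) ≤ 2 (ψ(β/2,h) − (β/2)(d + h))`** for `β > 0`, `h ≥ 0` (`E^∅ ≤ E⁺`). [cite: Ruelle1969, §2.6; FriedliVelenik2017, Thm. 3.6 and Exercise 3.3] -/
theorem mul_sub_plusEnergy_le {β h : ℝ} (hβ : 0 < β) (hh : 0 ≤ h) :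
    β * ((d + h) - (∑ i, plusCorr d β h {0, Pi.single i 1} + h * plusCorr d β h {0})) ≤
      2 * (pressure d (β / 2) h - β / 2 * (d + h)) := by
  have h1 := mul_sub_freeEnergyDensity_le (d := d) hβ hh
  have h2 := mul_le_mul_of_nonneg_left (freeEnergyField_le_plusEnergyField (d := d) hβ.le hh) hβ.le
  nlinarith

/-- **`E^∅(β,h) = Σᵢ ⟨σ_0σ_{eᵢ}⟩^∅_{β,h} + h⟨σ_0⟩^∅_{β,h} → d + h` as `β → ∞`** (`d ≥ 1`, `h ≥ 0`): the free-state energy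
density tends to the ground-state value. [cite: Simon1993, §II.3; FriedliVelenik2017, Exercise 3.3] -/
theorem tendsto_freeEnergyDensity_atTop (hd : 1 ≤ d) {h : ℝ} (hh : 0 ≤ h) :
    Tendsto (fun β => ∑ i, freeCorr d β h ({0, Pi.single i 1} : Finset (Site d)) + h * freeCorr d β h {0}) atTop
      (𝓝 (d + h)) := by
  -- `0 ≤ (d + h) − E^∅(β) ≤ 2 ε(β/2) / β` with `ε(b) = ψ(b,h) − b(d+h) → 0`
  have hε : Tendsto (fun β : ℝ => 2 * (pressure d (β / 2) h - β / 2 * (d + h)) / β) atTop (𝓝 0) := by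
    have h2 : Tendsto (fun β : ℝ => pressure d (β / 2) h - β / 2 * (d + |h|)) atTop (𝓝 0) :=
      (tendsto_pressure_sub_atTop_beta' hd h).comp (tendsto_id.atTop_div_const two_pos)
    rw [abs_of_nonneg hh] at h2
    have h3 := (h2.const_mul 2).div_atTop tendsto_id
    simpa using h3.congr fun β => rfl
  have hdiff : Tendsto (fun β : ℝ => (d + h) - (∑ i, freeCorr d β h ({0, Pi.single i 1} : Finset (Site d)) +
      h * freeCorr d β h {0})) atTop (𝓝 0) := by
    refine tendsto_of_tendsto_of_tendsto_of_le_of_le' tendsto_const_nhds hε ?_ ?_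
    · filter_upwards [eventually_ge_atTop 0] with β hβ
      have hs : ∑ i, freeCorr d β h ({0, Pi.single i 1} : Finset (Site d)) ≤ ∑ _i : Fin d, (1 : ℝ) :=
        sum_le_sum fun i _ => (freeCorr_le_plusCorr hβ hh _).trans (plusCorr_le_one hβ hh _)
      have hm : h * freeCorr d β h {0} ≤ h * 1 :=
        mul_le_mul_of_nonneg_left ((freeCorr_le_plusCorr hβ hh _).trans (plusCorr_le_one hβ hh _)) hh
      simp only [sum_const, card_univ, Fintype.card_fin, nsmul_eq_mul, mul_one] at hs hm
      linarith
    · filter_upwards [eventually_gt_atTop 0] with β hβ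
      rw [le_div_iff₀ hβ, mul_comm]
      exact mul_sub_freeEnergyDensity_le hβ hh
  have := (tendsto_const_nhds (x := (d : ℝ) + h)).sub hdiff
  rw [sub_zero] at this
  exact this.congr fun β => by ring

/-- **`E⁺(β,h) = Σᵢ ⟨σ_0σ_{eᵢ}⟩⁺_{β,h} + h⟨σ_0⟩⁺_{β,h} → d + h` as `β → ∞`** (`d ≥ 1`, `h ≥ 0`; `E^∅ ≤ E⁺ ≤ d + h`).
[cite: Simon1993, §II.3; FriedliVelenik2017, Exercise 3.3] -/
theorem tendsto_plusEnergy_atTop (hd : 1 ≤ d) {h : ℝ} (hh : 0 ≤ h) :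
    Tendsto (fun β => ∑ i, plusCorr d β h ({0, Pi.single i 1} : Finset (Site d)) + h * plusCorr d β h {0}) atTop
      (𝓝 (d + h)) := by
  refine tendsto_of_tendsto_of_tendsto_of_le_of_le' (tendsto_freeEnergyDensity_atTop hd hh) tendsto_const_nhds ?_ ?_
  · filter_upwards [eventually_ge_atTop 0] with β hβ using freeEnergyField_le_plusEnergyField hβ hh
  · filter_upwards [eventually_ge_atTop 0] with β hβ
    have hs : ∑ i, plusCorr d β h ({0, Pi.single i 1} : Finset (Site d)) ≤ ∑ _i : Fin d, (1 : ℝ) :=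
      sum_le_sum fun i _ => plusCorr_le_one hβ hh _
    have hm : h * plusCorr d β h {0} ≤ h * 1 := mul_le_mul_of_nonneg_left (plusCorr_le_one hβ hh _) hh
    simp only [sum_const, card_univ, Fintype.card_fin, nsmul_eq_mul, mul_one] at hs hm
    linarith

/-- **THE THIRD LAW (free-state form): `ψ(β,h) − β E^∅(β,h) → 0` as `β → ∞`** (`d ≥ 1`, `h ≥ 0`):
`0 ≤ ψ − βE^∅ = [ψ − β(d+h)] + β[(d+h) − E^∅] ≤ ε(β) + 2ε(β/2)`, `ε(b) = ψ(b,h) − b(d + h) → 0`.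
[cite: Simon1993, §II.3 and §II.6; Ruelle1969, §2.6] -/
theorem tendsto_pressure_sub_mul_freeEnergyDensity_atTop (hd : 1 ≤ d) {h : ℝ} (hh : 0 ≤ h) :
    Tendsto (fun β => pressure d β h - β * (∑ i, freeCorr d β h {0, Pi.single i 1} + h * freeCorr d β h {0}))
      atTop (𝓝 0) := by
  have hε1 : Tendsto (fun β : ℝ => pressure d β h - β * (d + h)) atTop (𝓝 0) := by
    have := tendsto_pressure_sub_atTop_beta' hd h
    rwa [abs_of_nonneg hh] at this
  have hε2 : Tendsto (fun β : ℝ => 2 * (pressure d (β / 2) h - β / 2 * (d + h))) atTop (𝓝 (2 * 0)) := by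
    have h2 : Tendsto (fun β : ℝ => pressure d (β / 2) h - β / 2 * (d + |h|)) atTop (𝓝 0) :=
      (tendsto_pressure_sub_atTop_beta' hd h).comp (tendsto_id.atTop_div_const two_pos)
    rw [abs_of_nonneg hh] at h2
    exact h2.const_mul 2
  rw [mul_zero] at hε2
  have hsum := hε1.add hε2
  rw [add_zero] at hsum
  refine tendsto_of_tendsto_of_tendsto_of_le_of_le' tendsto_const_nhds hsum ?_ ?_
  · filter_upwards [eventually_ge_atTop 0] with β hβ using pressure_sub_mul_freeEnergyDensity_nonneg hβ hh
  · filter_upwards [eventually_gt_atTop 0] with β hβ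
    have := mul_sub_freeEnergyDensity_le (d := d) hβ hh
    linarith

/-- **THE THIRD LAW: `ψ(β,h) − β E⁺(β,h) → 0` as `β → ∞`** (`d ≥ 1`, every `h ≥ 0`): the entropy density of the
nearest-neighbour Ising model vanishes at zero temperature (no residual entropy; at `h = 0` this is the Peierls count
of `PressureZeroTemperature`). [cite: Simon1993, §II.3 and §II.6; Ruelle1969, §2.6] -/
theorem tendsto_pressure_sub_mul_plusEnergy_atTop (hd : 1 ≤ d) {h : ℝ} (hh : 0 ≤ h) :
    Tendsto (fun β => pressure d β h - β * (∑ i, plusCorr d β h {0, Pi.single i 1} + h * plusCorr d β h {0}))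
      atTop (𝓝 0) := by
  refine tendsto_of_tendsto_of_tendsto_of_le_of_le' tendsto_const_nhds
    (tendsto_pressure_sub_mul_freeEnergyDensity_atTop hd hh) ?_ ?_
  · filter_upwards [eventually_ge_atTop 0] with β hβ using pressure_sub_mul_plusEnergy_nonneg hβ hh
  · filter_upwards [eventually_ge_atTop 0] with β hβ
    have := mul_le_mul_of_nonneg_left (freeEnergyField_le_plusEnergyField (d := d) hβ hh) hβ
    linarith

/-! ### In terms of `deriv ψ(·,h)` where the pressure is differentiable in `β` -/

/-- **`0 ≤ ψ(β,h) − β ∂ψ/∂β(β,h) ≤ log 2` at every `β > 0`, `h > 0`** (`d ≥ 1`; there `∂ψ/∂β = E⁺`,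
`hasDerivAt_pressure_beta_of_pos_field`). [cite: Ruelle1969, §2.6; FriedliVelenik2017, Thm. 3.25 (1) and Exercise 3.3] -/
theorem pressure_sub_mul_deriv_mem_Icc (hd : 1 ≤ d) {β h : ℝ} (hβ : 0 < β) (hh : 0 < h) :
    pressure d β h - β * deriv (fun b => pressure d b h) β ∈ Icc 0 (Real.log 2) := by
  rw [deriv_pressure_beta_of_pos_field hd hβ hh, magnetizationInField_eq_plusCorr]
  exact ⟨pressure_sub_mul_plusEnergy_nonneg hβ.le hh.le, pressure_sub_mul_plusEnergy_le_log_two hβ hh.le⟩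

/-- **The third law with `deriv`: `ψ(β,h) − β ∂ψ/∂β(β,h) → 0` as `β → ∞`** for every `h > 0` (`d ≥ 1`).
[cite: Simon1993, §II.3 and §II.6; Ruelle1969, §2.6] -/
theorem tendsto_pressure_sub_mul_deriv_atTop_of_pos_field (hd : 1 ≤ d) {h : ℝ} (hh : 0 < h) :
    Tendsto (fun β => pressure d β h - β * deriv (fun b => pressure d b h) β) atTop (𝓝 0) := by
  refine (tendsto_pressure_sub_mul_plusEnergy_atTop hd hh.le).congr' ?_
  filter_upwards [eventually_gt_atTop 0] with β hβ
  rw [deriv_pressure_beta_of_pos_field hd hβ hh, magnetizationInField_eq_plusCorr]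

end IsingPressure

end Summit.CriticalPhenomena.PercolationContinuityZ3.Theorems.FK

end
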